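import Mathlib
import Summits.AtomisticToContinuum.HydrodynamicLimit.Theorems.ImplosionDichotomyDenseExcursionSonicCavityDefsC

/-!
# Pointwise algebra of the bulk Levinson coefficients and the eight `CavityTubeBulk` envelopes
# (crux `DenseExcursion`, line `sonic-cavity-renewal` v7, brick for `stub_centreContent`)

Helper file (`--supports stmt-AtomisticToContinuum-12586`, line lead a2, stub-worker B for `stub_centreContent`).

In the `+` gauge of the mode system (`mode_levinson_form_plus`, `…SonicCentreContentGaugeA`) the slow variable
`u = e^{−θ}(ŵ + 3ŝ)` and the fast variable `w = e^{−θ}(ŵ − 3ŝ)` obey `u′ = α w`, `w′ = q w + β u` with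
`α = −b₊₋/c₊`, `β = −b₋₊/c₋`, `q = (Λ − b₋₋)/c₋ − (Λ − b₊₊)/c₊` (vocabulary `bulkCp`, `bulkCm`, `bulkBpp`, `bulkBmm`, `bulkBpm`,
`bulkBmp`, `bulkG`, `bulkH`, `bulkR` of `…SonicCavityDefsC`). THE KEY ALGEBRA (no small denominator anywhere):

  `q = 2S(Λ + R)/(c₊c₋)`,  `β/q = −G/(Λ + R)`,  `α/q = −H/(Λ + R)`,  `‖β/q‖‖α‖ = ‖α/q‖‖β‖ = |b₋₊||b₊₋|/(2S)/‖Λ + R‖`,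
  `Re q = (b₊₊/c₊ + b₋₋/|c₋|) − Re Λ·(1/c₊ + 1/|c₋|)`,  `‖Λ + R‖ ≥ |Im Λ|` (`R` is real),

so that the eight pointwise envelopes of `CavityTubeBulk` on `[log(1/100), −7/10]`, divided by `|Im Λ| > 1000`, are EXACTLY the
pointwise hypotheses of the bulk bootstrap `levinson_bulk_bootstrap` (`…SonicCentreContentBulkBootstrap`):
`bulk_levinson_point` (registered helper). Sources: Coppel 1965 Ch. IV (no citation is load-bearing).
-/

noncomputable section

open Set Filter
open scoped Topology ContDiff

namespace Summit.AtomisticToContinuum.HydrodynamicLimit.Theorems.SonicCavityRenewal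

open Summit.AtomisticToContinuum.HydrodynamicLimit.Theorems.R2OneModeTwoConditions

/-! ## The key algebra at a point -/

/-- `q = 2S(Λ + R)/(c₊ c₋)` wherever `c₊ c₋ S ≠ 0` (`c₊ − c₋ = 2S`, `c₋b₊₊ − c₊b₋₋ = 2S·R`). [folklore] -/
theorem bulk_q_eq {r : ℝ} {W S : ℝ → ℝ} {Λ : ℂ} {x : ℝ} (hp : bulkCp W S x ≠ 0) (hm : bulkCm W S x ≠ 0)
    (hS : S x ≠ 0) :
    (Λ - ((bulkBmm r W S x : ℝ) : ℂ)) / ((bulkCm W S x : ℝ) : ℂ) - (Λ - ((bulkBpp r W S x : ℝ) : ℂ)) / ((bulkCp W S x : ℝ) : ℂ) =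
      2 * ((S x : ℝ) : ℂ) * (Λ + ((bulkR r W S x : ℝ) : ℂ)) / (((bulkCp W S x : ℝ) : ℂ) * ((bulkCm W S x : ℝ) : ℂ)) := by
  have hp' : ((bulkCp W S x : ℝ) : ℂ) ≠ 0 := Complex.ofReal_ne_zero.2 hp
  have hm' : ((bulkCm W S x : ℝ) : ℂ) ≠ 0 := Complex.ofReal_ne_zero.2 hm
  have hS' : ((S x : ℝ) : ℂ) ≠ 0 := Complex.ofReal_ne_zero.2 hS
  rw [div_sub_div _ _ hm' hp', div_eq_div_iff (mul_ne_zero hm' hp') (mul_ne_zero hp' hm')]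
  have eR : ((bulkR r W S x : ℝ) : ℂ) * ((S x : ℝ) : ℂ) =
      -((2 / 3 * deriv W x + 2 * W x - r : ℝ) : ℂ) * ((S x : ℝ) : ℂ) +
        ((W x - 1 : ℝ) : ℂ) * ((2 * deriv S x + 4 * S x : ℝ) : ℂ) := by
    simp only [bulkR]
    push_cast
    field_simp
  have ep : ((bulkCp W S x : ℝ) : ℂ) = ((W x - 1 : ℝ) : ℂ) + ((S x : ℝ) : ℂ) := by simp only [bulkCp]; push_cast; ring
  have em : ((bulkCm W S x : ℝ) : ℂ) = ((W x - 1 : ℝ) : ℂ) - ((S x : ℝ) : ℂ) := by simp only [bulkCm]; push_cast; ring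
  have epp : ((bulkBpp r W S x : ℝ) : ℂ) =
      ((2 / 3 * deriv W x + 2 * W x - r : ℝ) : ℂ) + ((2 * deriv S x + 4 * S x : ℝ) : ℂ) := by
    simp only [bulkBpp]; push_cast; ring
  have emm : ((bulkBmm r W S x : ℝ) : ℂ) =
      ((2 / 3 * deriv W x + 2 * W x - r : ℝ) : ℂ) - ((2 * deriv S x + 4 * S x : ℝ) : ℂ) := by
    simp only [bulkBmm]; push_cast; ring
  rw [ep, em, epp, emm]
  linear_combination (-2 * ((((W x - 1 : ℝ) : ℂ) + ((S x : ℝ) : ℂ)) * (((W x - 1 : ℝ) : ℂ) - ((S x : ℝ) : ℂ)))) * eR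

/-- `β/q = −G/(Λ + R)` wherever `c₊ c₋ S (Λ + R) ≠ 0`. [folklore] -/
theorem bulk_beta_div_q {r : ℝ} {W S : ℝ → ℝ} {Λ : ℂ} {x : ℝ} (hp : bulkCp W S x ≠ 0) (hm : bulkCm W S x ≠ 0)
    (hS : S x ≠ 0) (hΛ : Λ + ((bulkR r W S x : ℝ) : ℂ) ≠ 0) :
    -((bulkBmp W S x : ℝ) : ℂ) / ((bulkCm W S x : ℝ) : ℂ) /
        ((Λ - ((bulkBmm r W S x : ℝ) : ℂ)) / ((bulkCm W S x : ℝ) : ℂ) - (Λ - ((bulkBpp r W S x : ℝ) : ℂ)) / ((bulkCp W S x : ℝ) : ℂ)) =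
      -((bulkG W S x : ℝ) : ℂ) / (Λ + ((bulkR r W S x : ℝ) : ℂ)) := by
  have hp' : ((bulkCp W S x : ℝ) : ℂ) ≠ 0 := Complex.ofReal_ne_zero.2 hp
  have hm' : ((bulkCm W S x : ℝ) : ℂ) ≠ 0 := Complex.ofReal_ne_zero.2 hm
  have hS' : ((S x : ℝ) : ℂ) ≠ 0 := Complex.ofReal_ne_zero.2 hS
  rw [bulk_q_eq hp hm hS]
  simp only [bulkG]
  push_cast
  field_simp

/-- `α/q = −H/(Λ + R)` wherever `c₊ c₋ S (Λ + R) ≠ 0`. [folklore] -/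
theorem bulk_alpha_div_q {r : ℝ} {W S : ℝ → ℝ} {Λ : ℂ} {x : ℝ} (hp : bulkCp W S x ≠ 0) (hm : bulkCm W S x ≠ 0)
    (hS : S x ≠ 0) (hΛ : Λ + ((bulkR r W S x : ℝ) : ℂ) ≠ 0) :
    -((bulkBpm W S x : ℝ) : ℂ) / ((bulkCp W S x : ℝ) : ℂ) /
        ((Λ - ((bulkBmm r W S x : ℝ) : ℂ)) / ((bulkCm W S x : ℝ) : ℂ) - (Λ - ((bulkBpp r W S x : ℝ) : ℂ)) / ((bulkCp W S x : ℝ) : ℂ)) =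
      -((bulkH W S x : ℝ) : ℂ) / (Λ + ((bulkR r W S x : ℝ) : ℂ)) := by
  have hp' : ((bulkCp W S x : ℝ) : ℂ) ≠ 0 := Complex.ofReal_ne_zero.2 hp
  have hm' : ((bulkCm W S x : ℝ) : ℂ) ≠ 0 := Complex.ofReal_ne_zero.2 hm
  have hS' : ((S x : ℝ) : ℂ) ≠ 0 := Complex.ofReal_ne_zero.2 hS
  rw [bulk_q_eq hp hm hS]
  simp only [bulkH]
  push_cast
  field_simp

/-- `Re q = (b₊₊/c₊ + b₋₋/|c₋|) − Re Λ·(1/c₊ + 1/|c₋|)` for `c₊ ≠ 0`, `c₋ < 0`. [folklore] -/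
theorem bulk_q_re {r : ℝ} {W S : ℝ → ℝ} {Λ : ℂ} {x : ℝ} (hp : bulkCp W S x ≠ 0) (hm : bulkCm W S x < 0) :
    ((Λ - ((bulkBmm r W S x : ℝ) : ℂ)) / ((bulkCm W S x : ℝ) : ℂ) - (Λ - ((bulkBpp r W S x : ℝ) : ℂ)) / ((bulkCp W S x : ℝ) : ℂ)).re =
      (bulkBpp r W S x / bulkCp W S x + bulkBmm r W S x / |bulkCm W S x|) -
        Λ.re * (1 / bulkCp W S x + 1 / |bulkCm W S x|) := by
  simp only [Complex.sub_re, Complex.div_ofReal_re, Complex.ofReal_re]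
  rw [abs_of_neg hm]
  field_simp
  ring

/-! ## Norm bounds -/

/-- `|Im Λ| ≤ ‖Λ + R‖` for real `R`. [folklore] -/
theorem abs_im_le_norm_add_real (Λ : ℂ) (R : ℝ) : |Λ.im| ≤ ‖Λ + (R : ℂ)‖ := by
  have h : (Λ + (R : ℂ)).im = Λ.im := by simp
  calc |Λ.im| = |(Λ + (R : ℂ)).im| := by rw [h]
    _ ≤ ‖Λ + (R : ℂ)‖ := Complex.abs_im_le_norm _

/-- `‖−G/z‖ ≤ |G|/I` when `‖z‖ ≥ I > 0`. [folklore] -/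
theorem norm_neg_real_div_le {G I : ℝ} {z : ℂ} (hI : 0 < I) (hz : I ≤ ‖z‖) : ‖-(G : ℂ) / z‖ ≤ |G| / I := by
  rw [norm_div, norm_neg, Complex.norm_real, Real.norm_eq_abs]
  exact div_le_div_of_nonneg_left (abs_nonneg _) hI hz

/-- The quotient-rule derivative of `−G/(Λ + R)` is at most `|G′|/1000 + |G||R′|/10⁶` when `‖Λ + R‖ ≥ 1000`. [folklore] -/
theorem norm_quot_deriv_le {G G' R' : ℝ} {z : ℂ} (hz : 1000 ≤ ‖z‖) :
    ‖(-((G' : ℝ) : ℂ) * z - -((G : ℝ) : ℂ) * ((R' : ℝ) : ℂ)) / z ^ 2‖ ≤ |G'| / 1000 + |G| * |R'| / 1000000 := by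
  rw [norm_div, norm_pow, div_le_iff₀ (by positivity)]
  have h1 : ‖-((G' : ℝ) : ℂ) * z - -((G : ℝ) : ℂ) * ((R' : ℝ) : ℂ)‖ ≤ |G'| * ‖z‖ + |G| * |R'| := by
    refine (norm_sub_le _ _).trans (le_of_eq ?_)
    rw [norm_mul, norm_neg, Complex.norm_real, norm_mul, norm_neg, Complex.norm_real, Complex.norm_real,
      Real.norm_eq_abs, Real.norm_eq_abs, Real.norm_eq_abs]
  have h2 : |G'| * ‖z‖ ≤ |G'| / 1000 * ‖z‖ ^ 2 := by
    have : ‖z‖ ≤ ‖z‖ ^ 2 / 1000 := by rw [le_div_iff₀ (by norm_num)]; nlinarith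
    nlinarith [abs_nonneg G']
  have h3 : |G| * |R'| ≤ |G| * |R'| / 1000000 * ‖z‖ ^ 2 := by
    have : (1 : ℝ) ≤ ‖z‖ ^ 2 / 1000000 := by rw [le_div_iff₀ (by norm_num)]; nlinarith
    nlinarith [mul_nonneg (abs_nonneg G) (abs_nonneg R')]
  nlinarith

/-! ## Differentiability of the bulk quantities -/

/-- The characteristic speeds and coefficients of a `C^∞` profile are differentiable. [folklore] -/
theorem differentiable_bulk {W S : ℝ → ℝ} (hW : ContDiff ℝ ∞ W) (hS : ContDiff ℝ ∞ S) (r : ℝ) :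
    Differentiable ℝ (bulkCp W S) ∧ Differentiable ℝ (bulkCm W S) ∧ Differentiable ℝ (bulkBpm W S) ∧
      Differentiable ℝ (bulkBmp W S) ∧ Differentiable ℝ (bulkBpp r W S) ∧ Differentiable ℝ (bulkBmm r W S) := by
  have hW1 : Differentiable ℝ W := hW.differentiable (by simp)
  have hS1 : Differentiable ℝ S := hS.differentiable (by simp)
  have hW2 : Differentiable ℝ (deriv W) := (contDiff_infty_iff_deriv.1 hW).2.differentiable (by simp)
  have hS2 : Differentiable ℝ (deriv S) := (contDiff_infty_iff_deriv.1 hS).2.differentiable (by simp)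
  refine ⟨?_, ?_, ?_, ?_, ?_, ?_⟩
  · show Differentiable ℝ (fun x => W x - 1 + S x)
    exact (hW1.sub_const 1).add hS1
  · show Differentiable ℝ (fun x => W x - 1 - S x)
    exact (hW1.sub_const 1).sub hS1
  · show Differentiable ℝ (fun x => deriv W x / 3 + deriv S x + 2 * S x)
    exact ((hW2.div_const 3).add hS2).add (hS1.const_mul 2)
  · show Differentiable ℝ (fun x => deriv W x / 3 - deriv S x - 2 * S x)
    exact ((hW2.div_const 3).sub hS2).sub (hS1.const_mul 2)
  · show Differentiable ℝ (fun x => 2 / 3 * deriv W x + 2 * W x - r + 2 * deriv S x + 4 * S x)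
    exact ((((hW2.const_mul _).add (hW1.const_mul 2)).sub_const r).add (hS2.const_mul 2)).add (hS1.const_mul 4)
  · show Differentiable ℝ (fun x => 2 / 3 * deriv W x + 2 * W x - r - 2 * deriv S x - 4 * S x)
    exact ((((hW2.const_mul _).add (hW1.const_mul 2)).sub_const r).sub (hS2.const_mul 2)).sub (hS1.const_mul 4)

/-- `G`, `H`, `R` are differentiable where `S ≠ 0`. [folklore] -/
theorem differentiableAt_bulkGHR {W S : ℝ → ℝ} (hW : ContDiff ℝ ∞ W) (hS : ContDiff ℝ ∞ S) (r : ℝ) {x : ℝ}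
    (hSx : S x ≠ 0) : DifferentiableAt ℝ (bulkG W S) x ∧ DifferentiableAt ℝ (bulkH W S) x ∧
      DifferentiableAt ℝ (bulkR r W S) x := by
  obtain ⟨hCp, hCm, hBpm, hBmp, -, -⟩ := differentiable_bulk hW hS r
  have hW1 : Differentiable ℝ W := hW.differentiable (by simp)
  have hS1 : Differentiable ℝ S := hS.differentiable (by simp)
  have hW2 : Differentiable ℝ (deriv W) := (contDiff_infty_iff_deriv.1 hW).2.differentiable (by simp)
  have hS2 : Differentiable ℝ (deriv S) := (contDiff_infty_iff_deriv.1 hS).2.differentiable (by simp)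
  have h2S : DifferentiableAt ℝ (fun y => 2 * S y) x := (hS1 x).const_mul 2
  have h2S0 : (2 : ℝ) * S x ≠ 0 := mul_ne_zero two_ne_zero hSx
  refine ⟨?_, ?_, ?_⟩
  · show DifferentiableAt ℝ (fun y => bulkBmp W S y * bulkCp W S y / (2 * S y)) x
    exact ((hBmp x).mul (hCp x)).div h2S h2S0
  · show DifferentiableAt ℝ (fun y => bulkBpm W S y * bulkCm W S y / (2 * S y)) x
    exact ((hBpm x).mul (hCm x)).div h2S h2S0
  · show DifferentiableAt ℝ (fun y => -(2 / 3 * deriv W y + 2 * W y - r) + (W y - 1) * (2 * deriv S y + 4 * S y) / S y) x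
    exact ((((hW2 x).const_mul _).add ((hW1 x).const_mul 2)).sub_const r).neg.add
      ((((hW1 x).sub_const 1).mul (((hS2 x).const_mul 2).add ((hS1 x).const_mul 4))).div (hS1 x) hSx)

/-! ## The pointwise Levinson data from the bulk envelopes -/

/-- Signs on the core: `c₊ > 0`, `c₋ < 0`, `S > 0`, `‖Λ + R‖ ≥ |Im Λ|`, for `y < 0`. [folklore] -/
theorem bulk_signs {r : ℝ} {W S : ℝ → ℝ} (hP : IsMonatomicProfile r W S) (hT : CavityTube r W S) {y : ℝ} (hy : y < 0) :
    0 < bulkCp W S y ∧ bulkCm W S y < 0 ∧ 0 < S y := by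
  obtain ⟨-, -, -, -, hSpos, -⟩ := hP
  obtain ⟨-, hsup, -, -, -, -, -, hcW, -, -, -⟩ := hT
  have hSy : 0 < S y := hSpos y
  have hcp : 0 < bulkCp W S y := by have := hsup y hy; simp only [bulkCp]; linarith
  have hWy : |W y| ≤ 1 / 4 := (hcW y (by linarith)).1
  have hcm : bulkCm W S y < 0 := by simp only [bulkCm]; have := (abs_le.mp hWy).2; linarith
  exact ⟨hcp, hcm, hSy⟩

/-- **THE POINTWISE LEVINSON DATA** — registered helper `bulk_levinson_point` for `stub_centreContent`. At a point `x` of the bulk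
`[log(1/100), −7/10]` of a monatomic tube profile with the bulk envelopes, for `−1/4 < Re Λ`, `|Im Λ| > 1000`, the `+`-gauge
coefficients `α = −b₊₋/c₊`, `β = −b₋₊/c₋`, `q = (Λ − b₋₋)/c₋ − (Λ − b₊₊)/c₊` satisfy: `q ≠ 0`; the growth bound
`Re q ≤ (77/20)eˣ + 5e^{3x} + 12e^{5x}`; `‖β/q‖ ≤ e^{−x}/2000`; `‖β/q‖‖α‖, ‖α/q‖‖β‖ ≤ (53/10⁵)e^{−x}`;
`‖α/q‖ ≤ (0.51e^{−x} + 0.61)/1000`; `β/q`, `α/q` are differentiable at `x` with `‖(β/q)′‖ ≤ (13/25000)e^{−x}`,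
`‖(α/q)′‖eˣ ≤ 511/10⁶`. [folklore] -/
theorem bulk_levinson_point : ∀ (r : ℝ) (W S : ℝ → ℝ) (Λ : ℂ) (x : ℝ), IsMonatomicProfile r W S → CavityTube r W S → CavityTubeBulk r W S → Real.log (1 / 100) ≤ x → x ≤ -(7 / 10) → -(1 / 4 : ℝ) < Λ.re → 1000 < |Λ.im| → ((Λ - ((bulkBmm r W S x : ℝ) : ℂ)) / ((bulkCm W S x : ℝ) : ℂ) - (Λ - ((bulkBpp r W S x : ℝ) : ℂ)) / ((bulkCp W S x : ℝ) : ℂ) ≠ 0 ∧ ((Λ - ((bulkBmm r W S x : ℝ) : ℂ)) / ((bulkCm W S x : ℝ) : ℂ) - (Λ - ((bulkBpp r W S x : ℝ) : ℂ)) / ((bulkCp W S x : ℝ) : ℂ)).re ≤ 77 / 20 * Real.exp x + 5 * Real.exp x ^ 3 + 12 * Real.exp x ^ 5) ∧ (‖-((bulkBmp W S x : ℝ) : ℂ) / ((bulkCm W S x : ℝ) : ℂ) / ((Λ - ((bulkBmm r W S x : ℝ) : ℂ)) / ((bulkCm W S x : ℝ) : ℂ) - (Λ - ((bulkBpp r W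 S x : ℝ) : ℂ)) / ((bulkCp W S x : ℝ) : ℂ))‖ ≤ Real.exp (-x) / 2000 ∧ ‖-((bulkBmp W S x : ℝ) : ℂ) / ((bulkCm W S x : ℝ) : ℂ) / ((Λ - ((bulkBmm r W S x : ℝ) : ℂ)) / ((bulkCm W S x : ℝ) : ℂ) - (Λ - ((bulkBpp r W S x : ℝ) : ℂ)) / ((bulkCp W S x : ℝ) : ℂ))‖ * ‖-((bulkBpm W S x : ℝ) : ℂ) / ((bulkCp W S x : ℝ) : ℂ)‖ ≤ 53 / 100000 * Real.exp (-x) ∧ ‖-((bulkBpm W S x : ℝ) : ℂ) / ((bulkCp W S x : ℝ) : ℂ) / ((Λ - ((bulkBmm r W S x : ℝ) : ℂ)) / ((bulkCm W S x : ℝ) : ℂ) - (Λ - ((bulkBpp r W S x : ℝ) : ℂ)) / ((bulkCp W S x : ℝ) : ℂ))‖ * ‖-((bulkBmp W S x : ℝ) : ℂ) / ((bulkCm W S x : ℝ) : ℂ)‖ ≤ 53 / 100000 * Real.exp (-x) ∧ ‖-((bulkBpm W S x : ℝ) : ℂ) / ((bulkCp W S x : ℝ) : ℂ) / ((Λ -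 ((bulkBmm r W S x : ℝ) : ℂ)) / ((bulkCm W S x : ℝ) : ℂ) - (Λ - ((bulkBpp r W S x : ℝ) : ℂ)) / ((bulkCp W S x : ℝ) : ℂ))‖ ≤ (51 / 100 * Real.exp (-x) + 61 / 100) / 1000) ∧ (DifferentiableAt ℝ (fun y => -((bulkBmp W S y : ℝ) : ℂ) / ((bulkCm W S y : ℝ) : ℂ) / ((Λ - ((bulkBmm r W S y : ℝ) : ℂ)) / ((bulkCm W S y : ℝ) : ℂ) - (Λ - ((bulkBpp r W S y : ℝ) : ℂ)) / ((bulkCp W S y : ℝ) : ℂ))) x ∧ ‖deriv (fun y => -((bulkBmp W S y : ℝ) : ℂ) / ((bulkCm W S y : ℝ) : ℂ) / ((Λ - ((bulkBmm r W S y : ℝ) : ℂ)) / ((bulkCm W S y : ℝ) : ℂ) - (Λ - ((bulkBpp r W S y : ℝ) : ℂ)) / ((bulkCp W S y : ℝ) : ℂ))) x‖ ≤ 13 / 25000 * Real.exp (-x)) ∧ (DifferentiableAt ℝ (fun y => -((bulkBpm W S y : ℝ) : ℂ) / ((bulkCp W S y : ℝ) : ℂ) / ((Λ - ((bulkBmm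 r W S y : ℝ) : ℂ)) / ((bulkCm W S y : ℝ) : ℂ) - (Λ - ((bulkBpp r W S y : ℝ) : ℂ)) / ((bulkCp W S y : ℝ) : ℂ))) x ∧ ‖deriv (fun y => -((bulkBpm W S y : ℝ) : ℂ) / ((bulkCp W S y : ℝ) : ℂ) / ((Λ - ((bulkBmm r W S y : ℝ) : ℂ)) / ((bulkCm W S y : ℝ) : ℂ) - (Λ - ((bulkBpp r W S y : ℝ) : ℂ)) / ((bulkCp W S y : ℝ) : ℂ))) x‖ * Real.exp x ≤ 511 / 1000000) := by
  intro r W S Λ x hP hT hB hxa hxb hre him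
  have hPc := hP
  have hTc := hT
  obtain ⟨-, -, hW, hS, hSpos, -⟩ := hPc
  have hx0 : x < 0 := by linarith
  obtain ⟨hcp, hcm, hSx⟩ := bulk_signs hP hT hx0
  obtain ⟨hB1, hB2, hB3, hB4, hB5, hB6, hB7, hB8⟩ := hB x hxa hxb
  have hI : 1000 ≤ ‖Λ + ((bulkR r W S x : ℝ) : ℂ)‖ := him.le.trans (abs_im_le_norm_add_real Λ _)
  have hΛR : Λ + ((bulkR r W S x : ℝ) : ℂ) ≠ 0 := fun h => by rw [h, norm_zero] at hI; linarith
  have hp' : ((bulkCp W S x : ℝ) : ℂ) ≠ 0 := Complex.ofReal_ne_zero.2 hcp.ne'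
  have hm' : ((bulkCm W S x : ℝ) : ℂ) ≠ 0 := Complex.ofReal_ne_zero.2 hcm.ne
  have hS' : ((S x : ℝ) : ℂ) ≠ 0 := Complex.ofReal_ne_zero.2 hSx.ne'
  have hex0 : 0 < Real.exp (-x) := Real.exp_pos _
  -- norms of the bare couplings
  have hα : ‖-((bulkBpm W S x : ℝ) : ℂ) / ((bulkCp W S x : ℝ) : ℂ)‖ = |bulkBpm W S x| / bulkCp W S x := by
    rw [norm_div, norm_neg, Complex.norm_real, Complex.norm_real, Real.norm_eq_abs, Real.norm_eq_abs, abs_of_pos hcp]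
  have hβ : ‖-((bulkBmp W S x : ℝ) : ℂ) / ((bulkCm W S x : ℝ) : ℂ)‖ = |bulkBmp W S x| / |bulkCm W S x| := by
    rw [norm_div, norm_neg, Complex.norm_real, Complex.norm_real, Real.norm_eq_abs, Real.norm_eq_abs]
  have hGα : |bulkG W S x| * (|bulkBpm W S x| / bulkCp W S x) = |bulkBmp W S x| * |bulkBpm W S x| / (2 * S x) := by
    simp only [bulkG]
    rw [abs_div, abs_mul, abs_of_pos hcp, abs_of_pos (by positivity : (0 : ℝ) < 2 * S x)]
    field_simp
  have hHβ : |bulkH W S x| * (|bulkBmp W S x| / |bulkCm W S x|) = |bulkBmp W S x| * |bulkBpm W S x| / (2 * S x) := by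
    simp only [bulkH]
    have hcm0 : 0 < |bulkCm W S x| := abs_pos.2 hcm.ne
    rw [abs_div, abs_mul, abs_of_pos (by positivity : (0 : ℝ) < 2 * S x)]
    field_simp
  refine ⟨⟨?_, ?_⟩, ⟨?_, ?_, ?_, ?_⟩, ?_, ?_⟩
  · -- `q ≠ 0`
    rw [bulk_q_eq hcp.ne' hcm.ne hSx.ne']
    exact div_ne_zero (mul_ne_zero (mul_ne_zero two_ne_zero hS') hΛR) (mul_ne_zero hp' hm')
  · -- the growth bound
    rw [bulk_q_re hcp.ne' hcm]
    have hτ0 : 0 ≤ 1 / bulkCp W S x + 1 / |bulkCm W S x| := by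
      have := abs_pos.2 hcm.ne; positivity
    have hquarter : -(Λ.re * (1 / bulkCp W S x + 1 / |bulkCm W S x|)) ≤
        1 / 4 * (1 / bulkCp W S x + 1 / |bulkCm W S x|) := by
      nlinarith [mul_nonneg (show (0 : ℝ) ≤ Λ.re + 1 / 4 by linarith) hτ0]
    have e2 : Real.exp (2 * x) = Real.exp x ^ 2 := by
      rw [show (2 : ℝ) * x = ((2 : ℕ) : ℝ) * x by norm_num, Real.exp_nat_mul]
    have e4 : Real.exp (4 * x) = Real.exp x ^ 4 := by
      rw [show (4 : ℝ) * x = ((4 : ℕ) : ℝ) * x by norm_num, Real.exp_nat_mul]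
    rw [e2, e4] at hB7 hB8
    have hE0 : 0 < Real.exp x := Real.exp_pos x
    nlinarith [hB7, hB8, hquarter, pow_pos hE0 3, pow_pos hE0 5]
  · -- `‖β/q‖`
    rw [bulk_beta_div_q hcp.ne' hcm.ne hSx.ne' hΛR]
    calc ‖-((bulkG W S x : ℝ) : ℂ) / (Λ + ((bulkR r W S x : ℝ) : ℂ))‖ ≤ |bulkG W S x| / 1000 :=
          norm_neg_real_div_le (by norm_num) hI
      _ ≤ Real.exp (-x) / 2000 := by rw [div_le_div_iff₀ (by norm_num) (by norm_num)]; linarith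
  · -- `‖β/q‖‖α‖`
    rw [bulk_beta_div_q hcp.ne' hcm.ne hSx.ne' hΛR, hα, norm_div, norm_neg, Complex.norm_real, Real.norm_eq_abs]
    calc |bulkG W S x| / ‖Λ + ((bulkR r W S x : ℝ) : ℂ)‖ * (|bulkBpm W S x| / bulkCp W S x)
        = |bulkBmp W S x| * |bulkBpm W S x| / (2 * S x) / ‖Λ + ((bulkR r W S x : ℝ) : ℂ)‖ := by
          rw [← hGα]; ring
      _ ≤ 53 / 100 * Real.exp (-x) / ‖Λ + ((bulkR r W S x : ℝ) : ℂ)‖ := div_le_div_of_nonneg_right hB5 (norm_nonneg _)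
      _ ≤ 53 / 100 * Real.exp (-x) / 1000 := div_le_div_of_nonneg_left (by positivity) (by norm_num) hI
      _ = 53 / 100000 * Real.exp (-x) := by ring
  · -- `‖α/q‖‖β‖`
    rw [bulk_alpha_div_q hcp.ne' hcm.ne hSx.ne' hΛR, hβ, norm_div, norm_neg, Complex.norm_real, Real.norm_eq_abs]
    calc |bulkH W S x| / ‖Λ + ((bulkR r W S x : ℝ) : ℂ)‖ * (|bulkBmp W S x| / |bulkCm W S x|)
        = |bulkBmp W S x| * |bulkBpm W S x| / (2 * S x) / ‖Λ + ((bulkR r W S x : ℝ) : ℂ)‖ := by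
          rw [← hHβ]; ring
      _ ≤ 53 / 100 * Real.exp (-x) / ‖Λ + ((bulkR r W S x : ℝ) : ℂ)‖ := div_le_div_of_nonneg_right hB5 (norm_nonneg _)
      _ ≤ 53 / 100 * Real.exp (-x) / 1000 := div_le_div_of_nonneg_left (by positivity) (by norm_num) hI
      _ = 53 / 100000 * Real.exp (-x) := by ring
  · -- `‖α/q‖`
    rw [bulk_alpha_div_q hcp.ne' hcm.ne hSx.ne' hΛR]
    calc ‖-((bulkH W S x : ℝ) : ℂ) / (Λ + ((bulkR r W S x : ℝ) : ℂ))‖ ≤ |bulkH W S x| / 1000 :=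
          norm_neg_real_div_le (by norm_num) hI
      _ ≤ (51 / 100 * Real.exp (-x) + 61 / 100) / 1000 := div_le_div_of_nonneg_right hB3 (by norm_num)
  · -- `(β/q)′`
    obtain ⟨hGd, -, hRd⟩ := differentiableAt_bulkGHR hW hS r hSx.ne'
    have hF := (hGd.hasDerivAt.ofReal_comp.fun_neg).fun_div (hRd.hasDerivAt.ofReal_comp.const_add Λ) hΛR
    have hev : (fun y => -((bulkBmp W S y : ℝ) : ℂ) / ((bulkCm W S y : ℝ) : ℂ) /
        ((Λ - ((bulkBmm r W S y : ℝ) : ℂ)) / ((bulkCm W S y : ℝ) : ℂ) - (Λ - ((bulkBpp r W S y : ℝ) : ℂ)) / ((bulkCp W S y : ℝ) : ℂ))) =ᶠ[𝓝 x]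
        (fun y => -((bulkG W S y : ℝ) : ℂ) / (Λ + ((bulkR r W S y : ℝ) : ℂ))) := by
      filter_upwards [Iio_mem_nhds hx0] with y hy
      obtain ⟨hcpy, hcmy, hSy⟩ := bulk_signs hP hT (show y < 0 from hy)
      have hIy : 1000 ≤ ‖Λ + ((bulkR r W S y : ℝ) : ℂ)‖ := him.le.trans (abs_im_le_norm_add_real Λ _)
      have hΛRy : Λ + ((bulkR r W S y : ℝ) : ℂ) ≠ 0 := fun h => by rw [h, norm_zero] at hIy; linarith
      exact bulk_beta_div_q hcpy.ne' hcmy.ne hSy.ne' hΛRy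
    have hd := hF.congr_of_eventuallyEq hev
    refine ⟨hd.differentiableAt, ?_⟩
    rw [hd.deriv]
    refine (norm_quot_deriv_le hI).trans ?_
    have hprod : |bulkG W S x| * |deriv (bulkR r W S) x| ≤ 1 / 2 * Real.exp (-x) * (1 / 5) :=
      mul_le_mul hB1 hB6 (abs_nonneg _) (by positivity)
    linarith
  · -- `(α/q)′`
    obtain ⟨-, hHd, hRd⟩ := differentiableAt_bulkGHR hW hS r hSx.ne'
    have hF := (hHd.hasDerivAt.ofReal_comp.fun_neg).fun_div (hRd.hasDerivAt.ofReal_comp.const_add Λ) hΛR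
    have hev : (fun y => -((bulkBpm W S y : ℝ) : ℂ) / ((bulkCp W S y : ℝ) : ℂ) /
        ((Λ - ((bulkBmm r W S y : ℝ) : ℂ)) / ((bulkCm W S y : ℝ) : ℂ) - (Λ - ((bulkBpp r W S y : ℝ) : ℂ)) / ((bulkCp W S y : ℝ) : ℂ))) =ᶠ[𝓝 x]
        (fun y => -((bulkH W S y : ℝ) : ℂ) / (Λ + ((bulkR r W S y : ℝ) : ℂ))) := by
      filter_upwards [Iio_mem_nhds hx0] with y hy
      obtain ⟨hcpy, hcmy, hSy⟩ := bulk_signs hP hT (show y < 0 from hy)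
      have hIy : 1000 ≤ ‖Λ + ((bulkR r W S y : ℝ) : ℂ)‖ := him.le.trans (abs_im_le_norm_add_real Λ _)
      have hΛRy : Λ + ((bulkR r W S y : ℝ) : ℂ) ≠ 0 := fun h => by rw [h, norm_zero] at hIy; linarith
      exact bulk_alpha_div_q hcpy.ne' hcmy.ne hSy.ne' hΛRy
    have hd := hF.congr_of_eventuallyEq hev
    refine ⟨hd.differentiableAt, ?_⟩
    rw [hd.deriv]
    have hE1 : Real.exp x ≤ 1 := Real.exp_le_one_iff.mpr hx0.le
    have hE0 : 0 < Real.exp x := Real.exp_pos x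
    have hinv : Real.exp (-x) * Real.exp x = 1 := by rw [← Real.exp_add, neg_add_cancel, Real.exp_zero]
    have h1 := norm_quot_deriv_le (G := bulkH W S x) (G' := deriv (bulkH W S) x) (R' := deriv (bulkR r W S) x) hI
    have hprod : |bulkH W S x| * |deriv (bulkR r W S) x| ≤ (51 / 100 * Real.exp (-x) + 61 / 100) * (1 / 5) :=
      mul_le_mul hB3 hB6 (abs_nonneg _) (by positivity)
    have h2 : ‖(-((deriv (bulkH W S) x : ℝ) : ℂ) * (Λ + ((bulkR r W S x : ℝ) : ℂ)) -
        -((bulkH W S x : ℝ) : ℂ) * ((deriv (bulkR r W S) x : ℝ) : ℂ)) / (Λ + ((bulkR r W S x : ℝ) : ℂ)) ^ 2‖ ≤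
        51 / 100000 * Real.exp (-x) + (51 / 100 * Real.exp (-x) + 61 / 100) * (1 / 5) / 1000000 := by
      linarith
    have h3 := mul_le_mul_of_nonneg_right h2 hE0.le
    nlinarith [h3, hinv, hE1]

end Summit.AtomisticToContinuum.HydrodynamicLimit.Theorems.SonicCavityRenewal

end
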